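import Summits.ResolutionOfSingularities.ResolutionOfSingularities.Theorems.EquisingularLiftEquisingularLiftNatP1VBLiftSection
import Literature.AlgebraicGeometry.Modules.PullbackFrame
import Literature.AlgebraicGeometry.Modules.SheafHomCoh
import HarnessLib

/-!
# [OURS · L1 W4.5(b) · T-P1VB part 10] The twisted two-chart Čech complex of `𝓗om(K, M)` for a chartwise-framed
# line bundle `K`, and its surjectivity upstairs from `Ȟ¹(𝓗om(g^*K, g^*M)) = 0` downstairs

Cell res-hironaka, LADDER-RESOLUTION rung L (D-0089), slot W4.5(b), crux `Theses.EquisingularLift.EquisingularLiftNat`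
(stmt-ResolutionOfSingularities-20038) / child `EquisingularLiftNatThree` (stmt-ResolutionOfSingularities-20148); object **T-P1VB**
(res-L1-w45b-lead-2 BOOK 2026-08-27T09:28:20Z), `--supports stmt-ResolutionOfSingularities-20148 --as helper`. NOT a statement of any
manuscript; OURS. AI-written; AI review is weaker than expert review.

WHY. The lift theorem of parts 2–5 is about SECTIONS of a vector bundle `F` and the hypothesis `Ȟ¹(g^*F) = 0`; the consumer
(DIR₀, `Theorems/…NatDirZeroDefs`) holds a sub-line-bundle `L₀ ↪ 𝒞_k = g^*𝒞` and the vanishing `Ȟ¹(𝓗om(L₀, 𝒞_k)) = 0` (part 9),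
with `L₀ ≅ g^*K̃` for a line bundle `K̃` on `ℙ¹_A` framed on the two standard charts (part 7). Instead of comparing `g^*𝓗om(K̃, 𝒞)`
with `𝓗om(g^*K̃, g^*𝒞)` as modules, this file computes the two-chart Čech complex of `𝓗om(K, M)` for ANY `K` framed (rank one) on
the two charts directly in terms of sections of `M` — the **twisted differential** `δ_u(s₀, s₁) = u·s₁| − s₀|`, `u` the transition
function `b₀| = u·b₁|` of the two frames — on both floors, and runs the Nakayama argument of part 2b for it.

WHAT. For `f : X → Spec A`, `U : Fin 2 → X.Opens`, `K, M` modules, frames `κ i : 𝒪 ≅ K|_{U i}` with generators `b_i`, and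
`u ∈ Γ(U₀ ∩ U₁, 𝒪)` with `b₀| = u • b₁|`:
* `evalEquiv` — `Γ(W, 𝓗om(K, M)) = Hom(K|_W, M|_W) ≃ₗ[A] Γ(W, M)`, `χ ↦ χ(b)`, for a rank-one frame of `K|_W`;
* `twistedDelta`, `evalEquiv_cechDelta` — under these identifications the Čech differential of `𝓗om(K, M)` is `δ_u`;
* **`subsingleton_cechMH1_sheafHom_iff`** — `Ȟ¹((U₀,U₁); 𝓗om(K, M)) = 0 ↔ δ_u` is onto;
* `gen_unitSection_rel` — the pulled-back frames `η(b_i)` of `g^*K` satisfy `η(b₀)| = g♯(u) • η(b₁)|`;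
* **`range_twistedDelta_eq_top`** — base change `g` of a surjection `φ : A → B` (`A` Noetherian local, `B ≠ 0`) along a proper
  `f`, `U₀, U₁, U₀ ∩ U₁` affine covering `X`, `K, M` coherent: `Ȟ¹((g⁻¹U₀, g⁻¹U₁); 𝓗om(g^*K, g^*M)) = 0 ⇒ δ_u` is onto upstairs
  (reduce, lift the two pieces — part 1 —, the error lies in `(ker φ)Γ(U₀ ∩ U₁, M)`; Nakayama with the finiteness of
  `Ȟ¹(𝓗om(K, M))` by dévissage, parts 2a/2b).

References (index only): Hartshorne II.5 (p. 110), III Thm. 5.1 (Čech complex of the standard cover), III §12 (base change).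
-/

noncomputable section

-- `TopCat.Presheaf`/`Scheme.Modules` are not reducible (as in Mathlib's `AlgebraicGeometry/Modules`).
set_option backward.isDefEq.respectTransparency false

open CategoryTheory AlgebraicGeometry TopologicalSpace Opposite
open Literature.AlgebraicGeometry.Morphisms Literature.AlgebraicGeometry.Modules Literature.AlgebraicGeometry

set_option linter.dupNamespace false -- mandated namespace `Summit.<Summit>.<Problem>` of this single-conjunct summit

namespace Summit.ResolutionOfSingularities.ResolutionOfSingularities.Cruxes.EquisingularLiftNat.P1VB

/-! ### `Hom(K|_W, M|_W) ≃ Γ(W, M)` for a rank-one frame of `K|_W` -/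

section Eval

variable {A : Type} [CommRing A] {X : Scheme.{0}} (f : X ⟶ Spec (.of A)) (K M : X.Modules) {W V : X.Opens}

/-- **Evaluation at the generator**: for a rank-one frame `e : 𝒪 ≅ K|_W` with basis section `b`, the `A`-linear
isomorphism `Γ(W, 𝓗om(K, M)) = Hom(K|_W, M|_W) ≃ Γ(W, M)`, `χ ↦ χ(b)`, with inverse `m ↦ (r b ↦ r m)`. [folklore] -/
def evalEquiv (e : SheafOfModules.free (Fin 1) ≅ K.over W) : MSections f (sheafHom K M) W ≃ₗ[A] MSections f M W where
  toFun χ := appLE (χ : K.over W ⟶ M.over W) (𝟙 W) (basisSection e 0)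
  invFun m := (homOfBasisValues e (fun _ => m) : K.over W ⟶ M.over W)
  map_add' χ χ' := appLE_add _ _ _ _
  map_smul' a χ := by
    change appLE (((algebraMap A (Sections f W) a : Sections f W) : Γ(X, W)) • (χ : K.over W ⟶ M.over W)) (𝟙 W)
        (basisSection e 0) = _
    rw [appLE_smul, structurePresheaf_map_id]
    rfl
  left_inv χ := hom_ext_of_basisSection e fun j => by
    obtain rfl : j = 0 := Subsingleton.elim _ _
    exact appLE_homOfBasisValues e _ 0
  right_inv m := appLE_homOfBasisValues e _ 0

/-- Unfolding `evalEquiv`. [folklore] -/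
theorem evalEquiv_apply (e : SheafOfModules.free (Fin 1) ≅ K.over W) (χ : MSections f (sheafHom K M) W) :
    evalEquiv f K M e χ = appLE (χ : K.over W ⟶ M.over W) (𝟙 W) (basisSection e 0) := rfl

/-- Values of the inverse: `(evalEquiv⁻¹ m)(r • b|) = r • m|`. [folklore] -/
theorem appLE_evalEquiv_symm (e : SheafOfModules.free (Fin 1) ≅ K.over W) (m : MSections f M W) (k : V ⟶ W)
    (r : Γ(X, V)) :
    appLE ((evalEquiv f K M e).symm m : K.over W ⟶ M.over W) k (r • K.presheaf.map k.op (basisSection e 0)) =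
      r • M.presheaf.map k.op m := by
  change appLE (homOfBasisValues e (fun _ => m)) k _ = _
  rw [appLE_smul_right, appLE_congr_hom _ k (k ≫ 𝟙 W), appLE_map, appLE_homOfBasisValues]

/-- Restriction of `Hom`-sections is `restrictHom`. [folklore] -/
theorem res_sheafHom_eq (h : V ≤ W) (χ : MSections f (sheafHom K M) W) :
    (MSections.res f (sheafHom K M) h χ : K.over V ⟶ M.over V) = restrictHom (homOfLE h) (χ : K.over W ⟶ M.over W) :=
  rfl

/-- `(χ|_V)(b|_V) = χ(b)|_V`: evaluation commutes with restriction (sections typed as `MSections`). [folklore] -/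
theorem appLE_res_map (h : V ≤ W) (χ : MSections f (sheafHom K M) W) (s : MSections f K W) :
    appLE (MSections.res f (sheafHom K M) h χ : K.over V ⟶ M.over V) (𝟙 V) (MSections.res f K h s) =
      MSections.res f M h (appLE (χ : K.over W ⟶ M.over W) (𝟙 W) s) := by
  rw [res_sheafHom_eq, appLE_restrictHom, appLE_congr_hom _ (𝟙 V ≫ homOfLE h) (homOfLE h ≫ 𝟙 W)]
  exact appLE_map _ _ _ _

/-- `χ(r • s) = r • χ(s)` with sections typed as `MSections` and scalars as `Sections`. [folklore] -/
theorem appLE_smul_right' (χ : K.over W ⟶ M.over W) (k : V ⟶ W) (r : Sections f V) (s : MSections f K V) :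
    (appLE χ k (r • s) : MSections f M V) =
      @HSMul.hSMul (Sections f V) (MSections f M V) (MSections f M V) instHSMul r (appLE χ k s) :=
  appLE_smul_right χ k r s

end Eval

/-! ### The twisted differential `δ_u(s) = u·s₁| − s₀|` -/

section Twisted

variable {A : Type} [CommRing A] {X : Scheme.{0}} (f : X ⟶ Spec (.of A)) (K M : X.Modules) (U : Fin 2 → X.Opens)

/-- **The twisted two-chart differential** `δ_u : Γ(U₀, M) × Γ(U₁, M) → Γ(U₀ ∩ U₁, M)`, `(s₀, s₁) ↦ u·s₁| − s₀|`
(`A`-linear). For `u = 1` this is part 2a's `cechDelta`. [folklore] -/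
def twistedDelta (u : Sections f (U 0 ⊓ U 1)) : CechMC0 f M U →ₗ[A] MSections f M (U 0 ⊓ U 1) where
  toFun s := u • MSections.res f M inf_le_right (s 1) - MSections.res f M inf_le_left (s 0)
  map_add' s s' := by
    simp only [Pi.add_apply, map_add, smul_add]
    abel
  map_smul' a s := by
    simp only [Pi.smul_apply, LinearMap.map_smul, RingHom.id_apply, smul_sub]
    rw [← MSections.algebraMap_smul f M _ a (MSections.res f M _ (s 1)), smul_smul, mul_comm, ← smul_smul,
      MSections.algebraMap_smul]

/-- Unfolding `twistedDelta`. [folklore] -/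
theorem twistedDelta_apply (u : Sections f (U 0 ⊓ U 1)) (s : CechMC0 f M U) :
    twistedDelta f M U u s = u • MSections.res f M inf_le_right (s 1) - MSections.res f M inf_le_left (s 0) := rfl

variable (κ : ∀ i, SheafOfModules.free (Fin 1) ≅ K.over (U i))

/-- The generator `b_i ∈ Γ(U_i, K)` of the `i`-th frame. [folklore] -/
def gen (i : Fin 2) : Γ(K, U i) := basisSection (κ i) 0

/-- The frame of `K|_{U₀ ∩ U₁}` restricted from `U₀`. [folklore] -/
def gen₀Frame : SheafOfModules.free (Fin 1) ≅ K.over (U 0 ⊓ U 1) :=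
  Motives.SheafOfModules.restrictTrivialisation (R := X.ringCatSheaf) (homOfLE (inf_le_left : U 0 ⊓ U 1 ≤ U 0)) (κ 0)

/-- Its basis section is `b₀|_{U₀ ∩ U₁}`. [folklore] -/
theorem basisSection_gen₀Frame :
    (basisSection (gen₀Frame K U κ) 0 : MSections f K (U 0 ⊓ U 1)) =
      MSections.res f K inf_le_left (gen K U κ 0 : MSections f K (U 0)) :=
  basisSection_restrictTrivialisation _ _ _

-- The transition function `u` of the two frames on `U₀ ∩ U₁`: `b₀| = u • b₁|` (for rank-one frames `u` is the
-- `1 × 1` transition matrix; only this relation is used).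
variable (u : Sections f (U 0 ⊓ U 1))
  (hu : MSections.res f K inf_le_left (gen K U κ 0 : MSections f K (U 0)) =
    u • MSections.res f K inf_le_right (gen K U κ 1 : MSections f K (U 1)))

/-- `appLE` of a difference of morphisms. [folklore] -/
theorem appLE_sub' {E N : X.Modules} {W V : X.Opens} (χ χ' : E.over W ⟶ N.over W) (k : V ⟶ W) (s : Γ(E, V)) :
    appLE (χ - χ') k s = appLE χ k s - appLE χ' k s :=
  map_sub (appLEHom k s) χ χ'

include hu in
/-- **The Čech differential of `𝓗om(K, M)` is the twisted differential**: evaluating `χ₁| − χ₀|` at `b₀| = u·b₁|` gives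
`u·χ₁(b₁)| − χ₀(b₀)|`. [folklore] -/
theorem evalEquiv_cechDelta (χ : CechMC0 f (sheafHom K M) U) :
    evalEquiv f K M (gen₀Frame K U κ) (cechDelta f (sheafHom K M) U χ) =
      twistedDelta f M U u (fun i => evalEquiv f K M (κ i) (χ i)) := by
  rw [evalEquiv_apply, cechDelta_apply, twistedDelta_apply]
  change (appLE ((MSections.res f (sheafHom K M) inf_le_right (χ 1) : K.over (U 0 ⊓ U 1) ⟶ M.over (U 0 ⊓ U 1)) -
      (MSections.res f (sheafHom K M) inf_le_left (χ 0) : K.over (U 0 ⊓ U 1) ⟶ M.over (U 0 ⊓ U 1))) (𝟙 _)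
      (basisSection (gen₀Frame K U κ) 0 : MSections f K (U 0 ⊓ U 1)) : MSections f M (U 0 ⊓ U 1)) = _
  rw [appLE_sub', basisSection_gen₀Frame f, appLE_res_map]
  conv_lhs => rw [hu]
  rw [appLE_smul_right', appLE_res_map, evalEquiv_apply, evalEquiv_apply]
  rfl

include hu in
/-- **`Ȟ¹((U₀, U₁); 𝓗om(K, M)) = 0` iff the twisted differential `δ_u` is onto.** [folklore] -/
theorem subsingleton_cechMH1_sheafHom_iff :
    Subsingleton (CechMH1 f (sheafHom K M) U) ↔ Function.Surjective (twistedDelta f M U u) := by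
  rw [subsingleton_cechMH1_iff]
  constructor
  · intro h m
    obtain ⟨χ, hχ⟩ := h ((evalEquiv f K M (gen₀Frame K U κ)).symm m)
    refine ⟨fun i => evalEquiv f K M (κ i) (χ i), ?_⟩
    rw [← evalEquiv_cechDelta f K M U κ u hu, hχ, LinearEquiv.apply_symm_apply]
  · intro h y
    obtain ⟨s, hs⟩ := h (evalEquiv f K M (gen₀Frame K U κ) y)
    refine ⟨fun i => (evalEquiv f K M (κ i)).symm (s i), (evalEquiv f K M (gen₀Frame K U κ)).injective ?_⟩
    rw [evalEquiv_cechDelta f K M U κ u hu, ← hs]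
    congr 1
    funext i
    rw [LinearEquiv.apply_symm_apply]

include hu in
/-- The image of the Čech boundaries under the evaluation is the image of `δ_u`. [folklore] -/
theorem map_range_cechDelta :
    (LinearMap.range (cechDelta f (sheafHom K M) U)).map
        (evalEquiv f K M (gen₀Frame K U κ) : MSections f (sheafHom K M) (U 0 ⊓ U 1) →ₗ[A] MSections f M (U 0 ⊓ U 1)) =
      LinearMap.range (twistedDelta f M U u) := by
  rw [← LinearMap.range_comp]
  ext m
  constructor
  · rintro ⟨χ, rfl⟩
    exact ⟨fun i => evalEquiv f K M (κ i) (χ i), (evalEquiv_cechDelta f K M U κ u hu χ).symm⟩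
  · rintro ⟨s, rfl⟩
    refine ⟨fun i => (evalEquiv f K M (κ i)).symm (s i), ?_⟩
    rw [LinearMap.comp_apply, LinearEquiv.coe_coe, evalEquiv_cechDelta f K M U κ u hu]
    congr 1
    funext i
    rw [LinearEquiv.apply_symm_apply]

end Twisted

/-! ### Base change: `δ_u` is onto upstairs if `Ȟ¹(𝓗om(g^*K, g^*M)) = 0` downstairs -/

section BaseChange

variable {A : Type} [CommRing A] {X : Scheme.{0}} (f : X ⟶ Spec (.of A)) (K M : X.Modules) (U : Fin 2 → X.Opens)
  (κ : ∀ i, SheafOfModules.free (Fin 1) ≅ K.over (U i)) (u : Sections f (U 0 ⊓ U 1))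
  (hu : MSections.res f K inf_le_left (gen K U κ 0 : MSections f K (U 0)) =
    u • MSections.res f K inf_le_right (gen K U κ 1 : MSections f K (U 1)))
  {B : Type} [CommRing B] (φ : A →+* B) {Y : Scheme.{0}} {g : Y ⟶ X} {t : Y ⟶ Spec (.of B)}

/-- `η(r • m) = g♯(r) • η(m)` with sections typed as `MSections` and scalars as `Sections`. [folklore] -/
theorem unitSection_smul' (V : X.Opens) (r : Sections f V) (m : MSections f M V) :
    (unitSection g M V (r • m) : MSections t ((Scheme.Modules.pullback g).obj M) (g ⁻¹ᵁ V)) =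
      @HSMul.hSMul (Sections t (g ⁻¹ᵁ V)) (MSections t ((Scheme.Modules.pullback g).obj M) (g ⁻¹ᵁ V)) _ instHSMul
        (g.app V r) (unitSection g M V m) :=
  unitSection_smul g M V r m

include hu in
/-- **The pulled-back frames have transition `g♯(u)`**: `η(b₀)| = g♯(u) • η(b₁)|` on `g⁻¹U₀ ∩ g⁻¹U₁`
(`η` is `g♯`-semilinear and commutes with restriction). [folklore] -/
theorem gen_unitSection_rel :
    MSections.res t ((Scheme.Modules.pullback g).obj K) inf_le_left
        (gen ((Scheme.Modules.pullback g).obj K) (fun i => g ⁻¹ᵁ U i) (fun i => pullbackFrame g (κ i)) 0 :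
          MSections t ((Scheme.Modules.pullback g).obj K) (g ⁻¹ᵁ U 0)) =
      @HSMul.hSMul (Sections t (g ⁻¹ᵁ U 0 ⊓ g ⁻¹ᵁ U 1))
        (MSections t ((Scheme.Modules.pullback g).obj K) (g ⁻¹ᵁ U 0 ⊓ g ⁻¹ᵁ U 1)) _ instHSMul
        (g.app (U 0 ⊓ U 1) u)
        (MSections.res t ((Scheme.Modules.pullback g).obj K) inf_le_right
          (gen ((Scheme.Modules.pullback g).obj K) (fun i => g ⁻¹ᵁ U i) (fun i => pullbackFrame g (κ i)) 1 :
            MSections t ((Scheme.Modules.pullback g).obj K) (g ⁻¹ᵁ U 1))) := by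
  simp only [gen, basisSection_pullbackFrame]
  change MSections.res t _ (Scheme.Hom.preimage_mono g inf_le_left) (unitSection g K (U 0) (gen K U κ 0)) =
    @HSMul.hSMul (Sections t (g ⁻¹ᵁ U 0 ⊓ g ⁻¹ᵁ U 1))
        (MSections t ((Scheme.Modules.pullback g).obj K) (g ⁻¹ᵁ U 0 ⊓ g ⁻¹ᵁ U 1)) _ instHSMul (g.app (U 0 ⊓ U 1) u)
      (MSections.res t _ (Scheme.Hom.preimage_mono g inf_le_right) (unitSection g K (U 1) (gen K U κ 1)))
  rw [← unitSection_res f (t := t) K (inf_le_left : U 0 ⊓ U 1 ≤ U 0),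
    ← unitSection_res f (t := t) K (inf_le_right : U 0 ⊓ U 1 ≤ U 1), hu, unitSection_smul' f K (t := t)]

include hu in
/-- **Step 1 — `Γ(U₀ ∩ U₁, M) = im δ_u + (ker φ)·Γ(U₀ ∩ U₁, M)`** from `Ȟ¹((g⁻¹U₀, g⁻¹U₁); 𝓗om(g^*K, g^*M)) = 0`: reduce `m`,
write `η(m) = δ_{g♯u}(c)` downstairs (criterion `subsingleton_cechMH1_sheafHom_iff` for the pulled-back frames), lift the two
pieces (part 1), and the error dies downstairs. [folklore] -/
theorem range_twistedDelta_sup_smul_top (hφ : Function.Surjective φ)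
    (H : IsPullback g t f (Spec.map (CommRingCat.ofHom φ))) (hM : IsAffineLocalizing M)
    (hU : ∀ i, IsAffineOpen (U i)) (hU01 : IsAffineOpen (U 0 ⊓ U 1))
    (h1 : Subsingleton (CechMH1 t (sheafHom ((Scheme.Modules.pullback g).obj K) ((Scheme.Modules.pullback g).obj M))
      (fun i => g ⁻¹ᵁ U i))) :
    LinearMap.range (twistedDelta f M U u) ⊔ RingHom.ker φ • ⊤ = (⊤ : Submodule A (MSections f M (U 0 ⊓ U 1))) := by
  have hsurj' := (subsingleton_cechMH1_sheafHom_iff t ((Scheme.Modules.pullback g).obj K)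
    ((Scheme.Modules.pullback g).obj M) (fun i => g ⁻¹ᵁ U i) (fun i => pullbackFrame g (κ i)) (g.app (U 0 ⊓ U 1) u)
    (gen_unitSection_rel f K U κ u hu)).mp h1
  refine eq_top_iff.mpr fun m _ => ?_
  obtain ⟨c, hc⟩ := hsurj' (unitSection g M (U 0 ⊓ U 1) m)
  choose s hs using fun i => unitSection_surjective_of_isPullback φ f hφ H M hM (hU i) (c i)
  refine Submodule.mem_sup.mpr ⟨twistedDelta f M U u s, ⟨s, rfl⟩, m - twistedDelta f M U u s, ?_, add_sub_cancel _ _⟩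
  rw [← unitSection_eq_zero_iff_mem_smul_top φ f hφ H M hM hU01, unitSection_sub, twistedDelta_apply, unitSection_sub,
    unitSection_smul' f M (t := t), unitSection_res f (t := t), unitSection_res f (t := t), hs, hs, sub_eq_zero, ← hc,
    twistedDelta_apply]
  rfl

variable [IsNoetherianRing A] [IsLocalRing A] [Nontrivial B] [IsProper f]

include hu in
/-- **Step 2 — `δ_u` is onto (Nakayama).** Base change `g` of a surjection `φ : A → B ≠ 0` (`A` Noetherian local) along a
proper `f : X → Spec A`, `X = U₀ ∪ U₁` with `U₀, U₁, U₀ ∩ U₁` affine, `K, M` coherent, `K` framed (rank one) on `U₀` and on `U₁`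
with transition `u`: if `Ȟ¹((g⁻¹U₀, g⁻¹U₁); 𝓗om(g^*K, g^*M)) = 0` then the twisted differential `δ_u : Γ(U₀, M) × Γ(U₁, M) →
Γ(U₀ ∩ U₁, M)` is onto — equivalently (`subsingleton_cechMH1_sheafHom_iff`) `Ȟ¹((U₀, U₁); 𝓗om(K, M)) = 0` upstairs. The quotient
is finite over `A` (`Ȟ¹(𝓗om(K, M))` is, by dévissage — `𝓗om(K, M)` is coherent) and equals `(ker φ)` times itself. [folklore] -/
theorem range_twistedDelta_eq_top (hφ : Function.Surjective φ)
    (H : IsPullback g t f (Spec.map (CommRingCat.ofHom φ))) (hK : Coh K) (hM : Coh M)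
    (hU : ∀ i, IsAffineOpen (U i)) (hU01 : IsAffineOpen (U 0 ⊓ U 1)) (hcov : ⨆ i, U i = ⊤)
    (h1 : Subsingleton (CechMH1 t (sheafHom ((Scheme.Modules.pullback g).obj K) ((Scheme.Modules.pullback g).obj M))
      (fun i => g ⁻¹ᵁ U i))) :
    LinearMap.range (twistedDelta f M U u) = ⊤ := by
  -- finiteness of `Ȟ¹(𝒰; 𝓗om(K, M))` by dévissage, hence of `Γ(U₀ ∩ U₁, M)/im δ_u` through `evalEquiv`
  haveI : IsLocallyNoetherian X := LocallyOfFiniteType.isLocallyNoetherian f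
  haveI : CompactSpace X := QuasiCompact.compactSpace_of_compactSpace f
  have hKM : InK f U (sheafHom K M) := devissage hU (heart_holds f hU hcov) _ (coh_sheafHom hK hM)
  haveI := hKM.finite_H1
  haveI := moduleFinite_quotient_range_cechDelta f (sheafHom K M) U
  haveI : Module.Finite A (MSections f M (U 0 ⊓ U 1) ⧸ LinearMap.range (twistedDelta f M U u)) :=
    Module.Finite.equiv (Submodule.Quotient.equiv _ _ (evalEquiv f K M (gen₀Frame K U κ))
      (map_range_cechDelta f K M U κ u hu))
  set N := LinearMap.range (twistedDelta f M U u) with hN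
  -- `Q = (ker φ) Q`
  have hle : (⊤ : Submodule A (MSections f M (U 0 ⊓ U 1) ⧸ N)) ≤ RingHom.ker φ • ⊤ := by
    rintro q -
    obtain ⟨y, rfl⟩ := Submodule.Quotient.mk_surjective N q
    have hy : y ∈ N ⊔ RingHom.ker φ • ⊤ := by
      rw [hN, range_twistedDelta_sup_smul_top f K M U κ u hu φ hφ H hM.loc hU hU01 h1]
      trivial
    obtain ⟨n, hn, z, hz, rfl⟩ := Submodule.mem_sup.mp hy
    rw [Submodule.Quotient.mk_add, (Submodule.Quotient.mk_eq_zero N).mpr hn, zero_add]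
    have hmap : (RingHom.ker φ • (⊤ : Submodule A (MSections f M (U 0 ⊓ U 1)))).map N.mkQ = RingHom.ker φ • ⊤ := by
      rw [Submodule.map_smul'', Submodule.map_top, Submodule.range_mkQ]
    rw [← hmap]
    exact ⟨z, hz, rfl⟩
  -- Nakayama
  have hbot := Submodule.eq_bot_of_le_smul_of_le_jacobson_bot (RingHom.ker φ)
    (⊤ : Submodule A (MSections f M (U 0 ⊓ U 1) ⧸ N)) Module.Finite.fg_top hle (ker_le_jacobson_bot φ)
  refine eq_top_iff.mpr fun y _ => ?_
  rw [← Submodule.Quotient.mk_eq_zero N, ← Submodule.mem_bot A, ← hbot]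
  trivial

include hu in
/-- The same, as the vanishing `Ȟ¹((U₀, U₁); 𝓗om(K, M)) = 0` UPSTAIRS. [folklore] -/
theorem subsingleton_cechMH1_sheafHom_of_pullback (hφ : Function.Surjective φ)
    (H : IsPullback g t f (Spec.map (CommRingCat.ofHom φ))) (hK : Coh K) (hM : Coh M)
    (hU : ∀ i, IsAffineOpen (U i)) (hU01 : IsAffineOpen (U 0 ⊓ U 1)) (hcov : ⨆ i, U i = ⊤)
    (h1 : Subsingleton (CechMH1 t (sheafHom ((Scheme.Modules.pullback g).obj K) ((Scheme.Modules.pullback g).obj M))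
      (fun i => g ⁻¹ᵁ U i))) :
    Subsingleton (CechMH1 f (sheafHom K M) U) :=
  (subsingleton_cechMH1_sheafHom_iff f K M U κ u hu).mpr
    (LinearMap.range_eq_top.mp (range_twistedDelta_eq_top f K M U κ u hu φ hφ H hK hM hU hU01 hcov h1))

end BaseChange

end Summit.ResolutionOfSingularities.ResolutionOfSingularities.Cruxes.EquisingularLiftNat.P1VB

end
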